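import Summits.QuantumFields.YangMills.Theorems.FluctuationComparisonRegPrIntLS2BetaLiftLadderArcProfile
import Summits.QuantumFields.YangMills.Theorems.FluctuationComparisonRegPrIntLS2BetaLiftLadderCombRow
import HarnessLib

/-!
# S2β · THE SUP CHAIN, (RSP-Σ) DISCHARGED FROM THE DATUM'S SMALL-BOND GUARD (architect ruling 19:55:50Z (iii) «(RSP) → the `Σ_j s_j` edition; holder px12»):
# along the two `AxStage` towers, the RELATIVE STAGE CHORDS have per-level sups `M_t` with `Σ_{1≤t≤K−J} M_t ≤ E(L,b₀,p₀)` — UNIFORM in `K`, `γ ≤ γ₁`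

Cell `ym3-torus` (YM ladder rung R3 = continuum `SU(2)` Yang–Mills on the three-torus at fixed lattice data — a RUNG: NOT d = 4, NOT infinite volume, NOT a mass gap,
NOT Clay).  Width seat «width 12» `ym3-torus-px12` (gen 26), FREE px helper on crux `stmt-QuantumFields-20520`; `--kind proof --supports stmt-QuantumFields-20520 --as
helper`, count-neutral, DEFINITION-FREE (0 `def`, 0 `instance`, 0 `notation`, 0 `sorry`, default heartbeats).

WHY (UV3-NODE §103.4 as amended 19:55:50Z: `c₁ = (K5′) + (BKG) + (RSP-Σ) + (β-3)′`).  The multiplicative `q·M·OSC` channel of the order-2 brick gives a factor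
`Π_j (1 + q₁′·M_j) ≤ exp (q₁′·Σ_j M_j)` in the `c₁` rows, `M_j` the per-level sup of the RELATIVE stage chords; (RSP-Σ) is the statement that `Σ_j M_j` is bounded.  The
ruling's suggested road (a contracting sup ladder `s_{j+1} ≤ (c∕L)s_j + C L²·2θ_j`, px21's engine ✓`…SupLadderSquareSum` §4) is ONE way; THIS FILE observes that the tree
already holds a stronger input: this lineage's ✓`…RelativeTowerSupBudget128.exists_gamma_supBudget_128` (px12 g24) gives, under the datum's small-bond guard
`arc ≤ 1∕128` and `θ := θBal`, for EACH tower an arc profile `s_t` with `Σ_{1≤t≤K−J} s_t ≤ E` (and `Σ s_t² ≤ E`, `s_t ≤ 1∕4`), `E = E(L,b₀,p₀)` chosen BEFORE `F, γ, J, K`;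
and a relative chord is at most the sum of the two absolute arcs.  So (RSP-Σ) is discharged with NO intra-block ladder and NO feedback condition — at the price that `E` is
an `O(1)` constant (not `O(Σθ)`-small), which is all the exponent `exp(q₁′·Σ_j M_j)` asks.

WHAT IS PROVED (sorry-free).  ★★★`relChordSum_of_smallBond_axStage` — hypotheses = ✓p832020 `arcProfile_of_smallBond_axStage`'s VERBATIM (guard, the four memberships of
`W, U₀`, the FULL `AxStage` witness rows `hwt hlift (T1)(T4)(T5) (T1′)(T4′)(T5′) (T6) (T5-res) hU₀`) PLUS the two gauge-covariance rows `hT3, hT3′` of ✓p831621 `combRow'`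
(`∀ X, ∀ j ≤ K−J, iter j (g_0 • X) = g_j • iter j X`); conclusion:
  `∃ M : ℕ → ℝ, (∀ t, 0 ≤ M t) ∧ (∀ t ≤ K−J, ∀ b, ‖log (W̄_t b·(Ū₀_t b)⁻¹)‖ ≤ M t) ∧ (∀ t ≤ K−J, M t ≤ 1∕2) ∧ Σ_{t<K−J} M (t+1) ≤ E`
(`M t := s t + s′ t`; ✓`norm_logVec_rawChord_eq_stageChord` + ✓`norm_logVec_mul_inv_le_add` of ✓p831211).  The finest level `t = 0` is in the sup clause (`≤ 1∕2`) and
outside the sum, exactly as in ✓`exists_gamma_supBudget_128`.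

HONEST SCOPE.  A composition of landed letters; the guard, `θBal`, `γ ≤ γ₁`, the memberships and the `AxStage` rows are HYPOTHESES; `E` is an unspecified constant of
`(L, b₀, p₀)`; nothing of Bałaban's renormalisation-group analysis is asserted or proved ([Balaban1985RegularSpaces] Lemma 1 (1.24)–(1.26) p.79, (1.29) p.81;
[Balaban1985UV3] (7) p.257 — the printed regularity ∕ small-field conventions); the `c₁` rows' use of (RSP-Σ), (β-3)′, (BKG), (K5′), the sup-ladder road (✓p832963-class
files H of this seat are its per-level row), LIFT-LADDER, (ST″), LOC, D-GUARD, GAP♯∘ (`stub_uniformFibreGapOrbit`, registry 3732b7df UNTOUCHED), the five registered stubs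
(0∕5), S2β, 20520, 19936, 19200, `YM3TorusSU2` are NOT proved; no registered stub is closed; rung R3 — NOT d = 4, NOT infinite volume, NOT a mass gap, NOT Clay; the
Yang–Mills mass gap is NOT proved.
-/

set_option autoImplicit false

namespace Summit.QuantumFields.YangMills.Theorems.FluctuationComparisonRegPrIntLS2BetaRspSigmaOfSmallBond

open Finset
open scoped Real
open Literature.MathematicalPhysics.QuantumLattice (su2Quat)
open Literature.MathematicalPhysics.QuantumFieldTheory.Balaban1983to89
open T4Continuum T3ContinuumYM3Torus T3UnitScaleTilt T3TiltDescent T3LevelShift BlockAveraging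
open T4CubeChartGnomonic (SU2)
open T4HaarSU2ExpChart (expPoint)
open T4ExpWindowSmallField (logVec)
open T3UnitLawDensityEML (ℰp)
open T3ConstrainedMinimiser (fibre)
open B10Eq27TorusAxialLog (rel axialT)
open Summit.QuantumFields.YangMills.Theorems.FluctuationComparisonRegPrIntLS2BetaRelativeTowerSupBudget128 (exists_gamma_supBudget_128)
open Summit.QuantumFields.YangMills.Theorems.FluctuationComparisonRegPrIntLS2BetaResidualGauge
  (gaugeAct_mul_eq gaugeAct_inv_gaugeAct gaugeAct_mem_fibre_iff_of_residual gaugeAct_mem_histGood_iff)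
open Summit.QuantumFields.YangMills.Theorems.FluctuationComparisonRegPrIntLS2BetaHFlatOfRelativeLetter (residual_of_iter_eq)

open Summit.QuantumFields.YangMills.Theorems.FluctuationComparisonRegPrIntLS2BetaLiftLadderCombRow (norm_logVec_rawChord_eq_stageChord norm_logVec_mul_inv_le_add)

/-- ★★★ **(RSP-Σ) FROM THE DATUM'S SMALL-BOND GUARD**: along the two `AxStage` towers (partner `W`, base `U₀ = (g_0⁻¹g₀_0) • U₁`), the relative stage chords
`W̄_t b·(Ū₀_t b)⁻¹` have per-level sups `M_t ≤ 1∕2` with `Σ_{1≤t≤K−J} M_t ≤ E(L,b₀,p₀)`, uniformly in `K` and `γ ≤ γ₁` (✓`exists_gamma_supBudget_128` ×2 + the arc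
triangle; hypotheses as in ✓p832020 §2 plus the gauge-covariance rows `hT3, hT3′`). [cite: Balaban1985RegularSpaces, Lemma 1 (1.24)-(1.26) p.79, (1.29) p.81] -/
theorem relChordSum_of_smallBond_axStage (L : ℕ) (hL : 1 < L) (b₀ p₀ : ℝ) (hb : 0 < b₀) (hp : 0 < p₀) :
    ∃ E : ℝ, 0 ≤ E ∧ ∃ γ₁ : ℝ, 0 < γ₁ ∧ ∀ (F : T3Family) (γ : ℝ), F.L = L → 0 < γ → γ ≤ γ₁ →
      ∀ (J K : ℕ) (hJK : J ≤ K) (V : GaugeField (F.P J) 0 SU2), (∀ e, ‖logVec (su2Quat (V e))‖ ≤ 1 / 128) →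
      ∀ (W U₀ : GaugeField (F.P K) 0 SU2), W ∈ fibre F ℰp J K hJK V → W ∈ histGood F ℰp (θBal F.L γ b₀ p₀) K J →
        U₀ ∈ fibre F ℰp J K hJK V → U₀ ∈ histGood F ℰp (θBal F.L γ b₀ p₀) K J →
      ∀ (wt : (j : ℕ) → PBond (F.P K) j → PBond (F.P K) (j + 1) → ℝ)
        (lift : (j : ℕ) → GaugeField (F.P K) (j + 1) SU2 → GaugeField (F.P K) j SU2)
        (U₁ : GaugeField (F.P K) 0 SU2) (g g₀ : (j : ℕ) → Site (F.P K) j → SU2),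
        (∀ j b e, wt j b e = if e.dir = b.dir ∧ (b.src b.dir - emb e.src b.dir).val < (F.P K).L then
          ∏ ν ∈ Finset.univ.erase b.dir, max 0 (1 - ((rel (emb e.src) b.src ν).natAbs : ℝ) / (F.P K).L) else 0) →
        (∀ j X b, lift j X b = expPoint (∑ e, wt j b e • ((((F.P K).L : ℕ) : ℝ)⁻¹ • logVec (su2Quat (X e))))) →
        (∀ j, K - J ≤ j → ∀ y, g j y = 1) →
        (∀ j, j < K - J → ∀ x,
          axialT (GaugeField.gaugeAct (g j) (Averaging.iter (fun k => blockAvg (P := F.P K) (j := k) ℰp) j W)) (emb (blockOf x)) x =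
            axialT (lift j (GaugeField.gaugeAct (g (j + 1)) (Averaging.iter (fun k => blockAvg (P := F.P K) (j := k) ℰp) (j + 1) W))) (emb (blockOf x)) x) →
        (∀ j, j < K - J →
          (blockAvg (P := F.P K) (j := j) ℰp).avg (GaugeField.gaugeAct (g j) (Averaging.iter (fun k => blockAvg (P := F.P K) (j := k) ℰp) j W)) =
            GaugeField.gaugeAct (g (j + 1)) (Averaging.iter (fun k => blockAvg (P := F.P K) (j := k) ℰp) (j + 1) W)) →
        (∀ j, K - J ≤ j → ∀ y, g₀ j y = 1) →
        (∀ j, j < K - J → ∀ x,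
          axialT (GaugeField.gaugeAct (g₀ j) (Averaging.iter (fun k => blockAvg (P := F.P K) (j := k) ℰp) j U₁)) (emb (blockOf x)) x =
            axialT (lift j (GaugeField.gaugeAct (g₀ (j + 1)) (Averaging.iter (fun k => blockAvg (P := F.P K) (j := k) ℰp) (j + 1) U₁))) (emb (blockOf x)) x) →
        (∀ j, j < K - J →
          (blockAvg (P := F.P K) (j := j) ℰp).avg (GaugeField.gaugeAct (g₀ j) (Averaging.iter (fun k => blockAvg (P := F.P K) (j := k) ℰp) j U₁)) =
            GaugeField.gaugeAct (g₀ (j + 1)) (Averaging.iter (fun k => blockAvg (P := F.P K) (j := k) ℰp) (j + 1) U₁)) →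
        (∀ X : GaugeField (F.P K) 0 SU2, Averaging.iter (fun k => blockAvg (P := F.P K) (j := k) ℰp) (K - J) (GaugeField.gaugeAct (fun x => (g 0 x)⁻¹) X) =
          Averaging.iter (fun k => blockAvg (P := F.P K) (j := k) ℰp) (K - J) X) →
        (∀ X : GaugeField (F.P K) 0 SU2, Averaging.iter (fun k => blockAvg (P := F.P K) (j := k) ℰp) (K - J) (GaugeField.gaugeAct (g₀ 0) X) =
          Averaging.iter (fun k => blockAvg (P := F.P K) (j := k) ℰp) (K - J) X) →
        U₀ = GaugeField.gaugeAct (fun x => (g 0 x)⁻¹ * g₀ 0 x) U₁ →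
        (∀ X : GaugeField (F.P K) 0 SU2, ∀ j, j ≤ K - J →
          Averaging.iter (fun k => blockAvg (P := F.P K) (j := k) ℰp) j (GaugeField.gaugeAct (g 0) X) =
            GaugeField.gaugeAct (g j) (Averaging.iter (fun k => blockAvg (P := F.P K) (j := k) ℰp) j X)) →
        (∀ X : GaugeField (F.P K) 0 SU2, ∀ j, j ≤ K - J →
          Averaging.iter (fun k => blockAvg (P := F.P K) (j := k) ℰp) j (GaugeField.gaugeAct (g₀ 0) X) =
            GaugeField.gaugeAct (g₀ j) (Averaging.iter (fun k => blockAvg (P := F.P K) (j := k) ℰp) j X)) →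
        ∃ M : ℕ → ℝ, (∀ t, 0 ≤ M t) ∧
          (∀ t, t ≤ K - J → ∀ b : PBond (F.P K) t,
            ‖logVec (su2Quat (Averaging.iter (fun k => blockAvg (P := F.P K) (j := k) ℰp) t W b *
              (Averaging.iter (fun k => blockAvg (P := F.P K) (j := k) ℰp) t U₀ b)⁻¹))‖ ≤ M t) ∧
          (∀ t, t ≤ K - J → M t ≤ 1 / 2) ∧ ∑ t ∈ Finset.range (K - J), M (t + 1) ≤ E := by
  obtain ⟨E, hE, γ₁, hγ₁, H⟩ := exists_gamma_supBudget_128 L hL b₀ p₀ hb hp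
  refine ⟨E + E, by positivity, γ₁, hγ₁, ?_⟩
  intro F γ hFL hγ hγ₁' J K hJK V hV W U₀ hWf hWg hU₀f hU₀g wt lift U₁ g g₀ hwt hlift hT1 hT4 hT5 hT1' hT4' hT5' hT6 hT5r hU₀ hT3 hT3'
  -- the fibre mate `U₁`'s memberships (as in ✓p832020 §2)
  have hwres : ∀ X : GaugeField (F.P K) 0 SU2,
      descendTo F ℰp J K hJK (GaugeField.gaugeAct (fun x => (g 0 x)⁻¹ * g₀ 0 x) X) = descendTo F ℰp J K hJK X := by
    refine residual_of_iter_eq F hJK _ fun X => ?_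
    have e1 : GaugeField.gaugeAct (fun x => (g 0 x)⁻¹ * g₀ 0 x) X =
        GaugeField.gaugeAct (fun x => (g 0 x)⁻¹) (GaugeField.gaugeAct (g₀ 0) X) := gaugeAct_mul_eq (fun x => (g 0 x)⁻¹) (g₀ 0) X
    rw [e1, hT6, hT5r]
  have hU₁f : U₁ ∈ fibre F ℰp J K hJK V := by
    rw [← gaugeAct_mem_fibre_iff_of_residual F hJK hwres U₁, ← hU₀]; exact hU₀f
  have hU₁g : U₁ ∈ histGood F ℰp (θBal F.L γ b₀ p₀) K J := by
    rw [← gaugeAct_mem_histGood_iff F (fun x => (g 0 x)⁻¹ * g₀ 0 x) (θBal F.L γ b₀ p₀) J U₁, ← hU₀]; exact hU₀g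
  -- the two towers' arc profiles with their level sums
  obtain ⟨s, hs0, hs, hs4, hsE, _⟩ := H F γ hFL hγ hγ₁' J K hJK V hV W hWf hWg g wt
    (fun t => lift t (GaugeField.gaugeAct (g (t + 1)) (Averaging.iter (fun k => blockAvg (P := F.P K) (j := k) ℰp) (t + 1) W)))
    (fun t _ b e => hwt t b e) (fun t _ b => hlift t _ b) hT1 (fun t ht z => hT4 t ht z) (fun t ht => hT5 t ht)
  obtain ⟨s', hs0', hs', hs4', hsE', _⟩ := H F γ hFL hγ hγ₁' J K hJK V hV U₁ hU₁f hU₁g g₀ wt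
    (fun t => lift t (GaugeField.gaugeAct (g₀ (t + 1)) (Averaging.iter (fun k => blockAvg (P := F.P K) (j := k) ℰp) (t + 1) U₁)))
    (fun t _ b e => hwt t b e) (fun t _ b => hlift t _ b) hT1' (fun t ht z => hT4' t ht z) (fun t ht => hT5' t ht)
  refine ⟨fun t => s t + s' t, fun t => add_nonneg (hs0 t) (hs0' t), fun t ht b => ?_, fun t ht => by linarith [hs4 t ht, hs4' t ht], ?_⟩
  · -- raw chord = stage chord (gauge move), then the arc triangle
    rw [norm_logVec_rawChord_eq_stageChord (fun k => blockAvg (P := F.P K) (j := k) ℰp) g g₀ W U₁ U₀ (fun X => hT3 X t ht) (fun X => hT3' X t ht) hU₀ b]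
    exact (norm_logVec_mul_inv_le_add _ _).trans (add_le_add (hs t ht b) (hs' t ht b))
  · rw [Finset.sum_add_distrib]; exact add_le_add hsE hsE'

end Summit.QuantumFields.YangMills.Theorems.FluctuationComparisonRegPrIntLS2BetaRspSigmaOfSmallBond
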